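import Mathlib
import Summits.NavierStokesRegularity.NavierStokesRegularity.Theorems.FilamentSkeletonRssSkeletonEquilibriumRosenheadMoments
import Summits.NavierStokesRegularity.NavierStokesRegularity.Theorems.FilamentSkeletonRssSkeletonEquilibriumRosenheadMomentBounds

/-!
# Clause 13-R, MODEL level: POINTWISE BOUND FOR THE TAYLOR-REMAINDER (straight self-induction) OPERATOR ON A SMOOTH WEIGHT —
# `|M_q[φ](τ)| ≤ 2A₂·L_{√q}(D) + (4A₀/D + 2A₁)·π/D`  (the «log of the window» leak of STUB R's pairing; item 3 of DIAG-23612-rate-row-leafhand3-g0)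

Route `FilamentSkeletonRss`, crux `Clause13RNearStraightL` (stmt-NavierStokesRegularity-23612), line `rate_bordered_split`, STUB R `stub_rateRow13RFlat`.
After the symmetry `⟨M_q Y, φ⟩ = ⟨Y, M_q φ⟩` (`…Clause13RTaylorRemainderSymmetry`, p822122) the window pairing sees the weight only through
`M_q[φ](τ) = ∫ ((τ−σ)²+q)^{-3/2} (φ τ − φ σ − (τ−σ) φ′σ) dσ`.  For `φ ∈ C²` with `|φ| ≤ A₀`, `|φ′| ≤ A₁`, `|φ″| ≤ A₂` and any split radius
`D > 0` this file proves the pointwise bound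

`|M_q[φ](τ)| ≤ 2A₂·(arsinh(D/√q) − D/√(D²+q)) + (4A₀/D + 2A₁)·(π/D)`,

i.e. second-order Taylor on the window `|τ−σ| ≤ D` against the LIA second moment `∫_{−D}^{D} s²K₃ = 2L_{√q}(D)` (landed
`SkeletonEquilibrium.Sketch.stub_rosenheadMoments`, with `L ≤ log(2D/√q) − 1 + q/D²` from `stub_rosenheadMomentBounds`), and the crude bound
`2A₀ + A₁|s|` against `K₃(s) ≤ |s|⁻³ ≤ (2/D)/(s²+D²)`-type tails off the window (`∫ (s²+D²)⁻¹ = π/D`).  For a bump of width `ℓ` (`A₀ = 1`, `A₁ ≍ 1/ℓ`,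
`A₂ ≍ 1/ℓ²`, `D = ℓ`) this is the `log(ℓ²/q)/ℓ²` size used in the DIAG memo's budget (§2).

* `abs_taylor2_le_sq` — `|φ τ − φ σ − (τ−σ)φ′σ| ≤ A₂ (τ−σ)²` (mean value on `r ↦ φ r + (τ−r)φ′r`);
* `abs_taylor2_le_crude` — `≤ 2A₀ + A₁|τ−σ|`;
* `integral_inv_sq_add_sq` — `∫ (s² + D²)⁻¹ ds = π/D`;
* `abs_taylorRemainderOp_le` — the pointwise bound (via `norm_integral_le_of_norm_le`: no integrability of the integrand is assumed).

Hand `leafhand-ns-filamentskeletonrs-3-g0` (LAND-ONLY); `--supports stmt-NavierStokesRegularity-23612 --as helper`.  HONEST FRAMING: one-dimensional calculus for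
the MODEL operator of a HYPOTHETICAL filament skeleton on the NEGATIVE side of a MODEL blow-up route; nothing here bears on Navier–Stokes regularity or
blow-up; STUB R is NOT proved here.
-/

noncomputable section

open MeasureTheory Filter Topology Set Real
open Summit.NavierStokesRegularity.NavierStokesRegularity.Theorems.SkeletonEquilibrium.Sketch (stub_rosenheadMoments stub_rosenheadMomentBounds)

namespace Summit.NavierStokesRegularity.NavierStokesRegularity.Theorems.Clause13RTaylorRemainderBounds
set_option linter.dupNamespace false

/-! ## §1 Two bounds for the second-order Taylor remainder -/

/-- **Second-order Taylor bound** (mean value on `r ↦ φ r + (τ − r)·φ′ r`, whose derivative is `(τ − r)·φ″ r`): if `|φ″| ≤ A₂` then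
`|φ τ − φ σ − (τ−σ)·φ′σ| ≤ A₂·(τ−σ)²`. [folklore] -/
theorem abs_taylor2_le_sq {φ : ℝ → ℝ} {A₂ : ℝ} (hφ : ContDiff ℝ 2 φ) (h2 : ∀ r, |deriv (deriv φ) r| ≤ A₂) (τ σ : ℝ) :
    |φ τ - φ σ - (τ - σ) * deriv φ σ| ≤ A₂ * (τ - σ) ^ 2 := by
  have hd1 : Differentiable ℝ φ := hφ.differentiable (by norm_num)
  have hd2 : Differentiable ℝ (deriv φ) := hφ.differentiable_deriv_two
  have hA₂ : 0 ≤ A₂ := (abs_nonneg _).trans (h2 0)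
  -- g r := φ r + (τ - r) * φ′ r,  g′ r = (τ - r) * φ″ r
  have hg : ∀ r ∈ Set.uIcc σ τ, HasDerivWithinAt (fun r => φ r + (τ - r) * deriv φ r) ((τ - r) * deriv (deriv φ) r) (Set.uIcc σ τ) r := by
    intro r _
    have h1 : HasDerivAt φ (deriv φ r) r := (hd1 r).hasDerivAt
    have h2' : HasDerivAt (deriv φ) (deriv (deriv φ) r) r := (hd2 r).hasDerivAt
    have h3 : HasDerivAt (fun r : ℝ => τ - r) (-1) r := by simpa using (hasDerivAt_id r).const_sub τ
    have h := h1.add (h3.mul h2')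
    refine (h.hasDerivWithinAt).congr_deriv ?_
    ring
  have hB : ∀ r ∈ Set.uIcc σ τ, ‖(τ - r) * deriv (deriv φ) r‖ ≤ A₂ * |τ - σ| := by
    intro r hr
    rw [Real.norm_eq_abs, abs_mul]
    have hle : |τ - r| ≤ |τ - σ| := Set.abs_sub_right_of_mem_uIcc hr
    calc |τ - r| * |deriv (deriv φ) r| ≤ |τ - σ| * A₂ := mul_le_mul hle (h2 r) (abs_nonneg _) (abs_nonneg _)
      _ = A₂ * |τ - σ| := mul_comm _ _
  have h := Convex.norm_image_sub_le_of_norm_hasDerivWithin_le hg hB (convex_uIcc σ τ) Set.left_mem_uIcc Set.right_mem_uIcc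
  have heq : (φ τ + (τ - τ) * deriv φ τ) - (φ σ + (τ - σ) * deriv φ σ) = φ τ - φ σ - (τ - σ) * deriv φ σ := by ring
  rw [heq, Real.norm_eq_abs, Real.norm_eq_abs] at h
  calc |φ τ - φ σ - (τ - σ) * deriv φ σ| ≤ A₂ * |τ - σ| * |τ - σ| := h
    _ = A₂ * (τ - σ) ^ 2 := by rw [mul_assoc, ← sq, sq_abs]

/-- **Crude Taylor bound**: `|φ τ − φ σ − (τ−σ)·φ′σ| ≤ 2A₀ + A₁|τ − σ|` when `|φ| ≤ A₀`, `|φ′| ≤ A₁`. [folklore] -/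
theorem abs_taylor2_le_crude {φ : ℝ → ℝ} {A₀ A₁ : ℝ} (h0 : ∀ r, |φ r| ≤ A₀) (h1 : ∀ r, |deriv φ r| ≤ A₁) (τ σ : ℝ) :
    |φ τ - φ σ - (τ - σ) * deriv φ σ| ≤ 2 * A₀ + A₁ * |τ - σ| := by
  have ha := h0 τ
  have hb := h0 σ
  have hc : |(τ - σ) * deriv φ σ| ≤ |τ - σ| * A₁ := by
    rw [abs_mul]; exact mul_le_mul_of_nonneg_left (h1 σ) (abs_nonneg _)
  calc |φ τ - φ σ - (τ - σ) * deriv φ σ| ≤ |φ τ - φ σ| + |(τ - σ) * deriv φ σ| := abs_sub _ _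
    _ ≤ (|φ τ| + |φ σ|) + |(τ - σ) * deriv φ σ| := by linarith [abs_sub (φ τ) (φ σ)]
    _ ≤ 2 * A₀ + A₁ * |τ - σ| := by linarith

/-! ## §2 The tail kernel `(s² + D²)⁻¹` -/

/-- `∫ (s² + D²)⁻¹ ds = π/D` for `D > 0`. [folklore] -/
theorem integral_inv_sq_add_sq {D : ℝ} (hD : 0 < D) : ∫ s : ℝ, (s ^ 2 + D ^ 2)⁻¹ = π / D := by
  have hfun : (fun s : ℝ => (s ^ 2 + D ^ 2)⁻¹) = fun s => (D ^ 2)⁻¹ * (1 + (s / D) ^ 2)⁻¹ := by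
    funext s
    have hD2 : D ^ 2 ≠ 0 := pow_ne_zero 2 hD.ne'
    rw [← mul_inv, mul_add, mul_one, div_pow, mul_div_cancel₀ _ hD2, add_comm]
  rw [hfun, integral_const_mul, Measure.integral_comp_div (fun s : ℝ => (1 + s ^ 2)⁻¹) D, integral_univ_inv_one_add_sq,
    abs_of_pos hD, smul_eq_mul]
  field_simp

/-- `(s² + D²)⁻¹` is integrable. [folklore] -/
theorem integrable_inv_sq_add_sq {D : ℝ} (hD : 0 < D) : Integrable (fun s : ℝ => (s ^ 2 + D ^ 2)⁻¹) := by
  have hm : 0 < min 1 (D ^ 2) := lt_min one_pos (pow_pos hD 2)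
  refine (integrable_inv_one_add_sq.const_mul (min 1 (D ^ 2))⁻¹).mono' ?_ (Eventually.of_forall fun s => ?_)
  · exact (((continuous_pow 2).add continuous_const).inv₀ fun s => (by positivity : (0:ℝ) < s ^ 2 + D ^ 2).ne').aestronglyMeasurable
  · have hpos : 0 < s ^ 2 + D ^ 2 := by positivity
    rw [Real.norm_of_nonneg (inv_nonneg.2 hpos.le), ← mul_inv]
    apply inv_anti₀ (by positivity)
    have h1 : min 1 (D ^ 2) ≤ 1 := min_le_left _ _
    have h2 : min 1 (D ^ 2) ≤ D ^ 2 := min_le_right _ _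
    nlinarith [sq_nonneg s]

/-! ## §3 The pointwise bound -/

/-- **POINTWISE BOUND FOR `M_q[φ]`.**  For `q > 0`, `D > 0` and `φ ∈ C²(ℝ)` with `|φ| ≤ A₀`, `|φ′| ≤ A₁`, `|φ″| ≤ A₂`:
`|∫ ((τ−σ)²+q)^{-3/2}(φ τ − φ σ − (τ−σ)φ′σ) dσ| ≤ 2A₂(arsinh(D/√q) − D/√(D²+q)) + (4A₀/D + 2A₁)(π/D)`.
Window `|τ−σ| ≤ D`: Taylor `A₂(τ−σ)²` against the second moment of the kernel; off the window: `2A₀ + A₁|s|` against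
`K₃(s) ≤ |s|⁻³ ≤ (2/D)(s²+D²)⁻¹` and `|s|K₃(s) ≤ s⁻² ≤ 2(s²+D²)⁻¹`. [folklore] -/
theorem abs_taylorRemainderOp_le {q D A₀ A₁ A₂ : ℝ} (hq : 0 < q) (hD : 0 < D) {φ : ℝ → ℝ} (hφ : ContDiff ℝ 2 φ)
    (h0 : ∀ r, |φ r| ≤ A₀) (h1 : ∀ r, |deriv φ r| ≤ A₁) (h2 : ∀ r, |deriv (deriv φ) r| ≤ A₂) (τ : ℝ) :
    |∫ σ : ℝ, (((τ - σ) ^ 2 + q) ^ (3 / 2 : ℝ))⁻¹ * (φ τ - φ σ - (τ - σ) * deriv φ σ)|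
      ≤ 2 * A₂ * (Real.arsinh (D / Real.sqrt q) - D / Real.sqrt (D ^ 2 + q)) + (4 * A₀ / D + 2 * A₁) * (π / D) := by
  have hA₀ : 0 ≤ A₀ := (abs_nonneg _).trans (h0 0)
  have hA₁ : 0 ≤ A₁ := (abs_nonneg _).trans (h1 0)
  have hA₂ : 0 ≤ A₂ := (abs_nonneg _).trans (h2 0)
  have hsq : 0 < Real.sqrt q := Real.sqrt_pos.2 hq
  set K3 : ℝ → ℝ := fun s => ((s ^ 2 + q) ^ (3 / 2 : ℝ))⁻¹ with hK3
  have hK3nn : ∀ s, 0 ≤ K3 s := fun s => inv_nonneg.2 (Real.rpow_nonneg (by positivity) _)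
  -- substitute `σ = τ − s`
  set g : ℝ → ℝ := fun s => K3 s * (φ τ - φ (τ - s) - s * deriv φ (τ - s)) with hg
  have hsub : ∫ σ : ℝ, (((τ - σ) ^ 2 + q) ^ (3 / 2 : ℝ))⁻¹ * (φ τ - φ σ - (τ - σ) * deriv φ σ) = ∫ s : ℝ, g s := by
    rw [← integral_sub_left_eq_self g volume τ]
    refine integral_congr_ae (Eventually.of_forall fun σ => ?_)
    simp only [hg, hK3, sub_sub_cancel]
  rw [hsub]
  -- the majorant
  set C : ℝ := 4 * A₀ / D + 2 * A₁ with hC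
  have hC0 : 0 ≤ C := by positivity
  set M : ℝ → ℝ := fun s => Set.indicator (Set.Icc (-D) D) (fun s => A₂ * (s ^ 2 * K3 s)) s + C * (s ^ 2 + D ^ 2)⁻¹ with hM
  -- integrability of the majorant
  have hσ : ∀ s : ℝ, 0 < s ^ 2 + q := fun s => by positivity
  have hK3c : Continuous K3 := (((continuous_pow 2).add continuous_const).rpow_const
    (fun s => Or.inl (hσ s).ne')).inv₀ (fun s => (Real.rpow_pos_of_pos (hσ s) _).ne')
  have hwin : Integrable (Set.indicator (Set.Icc (-D) D) (fun s => A₂ * (s ^ 2 * K3 s))) := by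
    rw [integrable_indicator_iff measurableSet_Icc]
    exact ((continuous_const.mul ((continuous_pow 2).mul hK3c)).continuousOn).integrableOn_compact isCompact_Icc
  have htail : Integrable (fun s : ℝ => C * (s ^ 2 + D ^ 2)⁻¹) := (integrable_inv_sq_add_sq hD).const_mul C
  have hMi : Integrable M := hwin.add htail
  -- pointwise domination
  have hdom : ∀ s, ‖g s‖ ≤ M s := by
    intro s
    rw [Real.norm_eq_abs]
    have hT1 : |φ τ - φ (τ - s) - s * deriv φ (τ - s)| ≤ A₂ * s ^ 2 := by
      have h := abs_taylor2_le_sq hφ h2 τ (τ - s)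
      rwa [sub_sub_cancel] at h
    have hT2 : |φ τ - φ (τ - s) - s * deriv φ (τ - s)| ≤ 2 * A₀ + A₁ * |s| := by
      have h := abs_taylor2_le_crude h0 h1 τ (τ - s)
      rwa [sub_sub_cancel] at h
    have hgs : |g s| = K3 s * |φ τ - φ (τ - s) - s * deriv φ (τ - s)| := by
      rw [hg]; simp only []; rw [abs_mul, abs_of_nonneg (hK3nn s)]
    have htail0 : 0 ≤ C * (s ^ 2 + D ^ 2)⁻¹ := mul_nonneg hC0 (inv_nonneg.2 (by positivity))
    by_cases hs : s ∈ Set.Icc (-D) D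
    · -- window
      have hind : Set.indicator (Set.Icc (-D) D) (fun s => A₂ * (s ^ 2 * K3 s)) s = A₂ * (s ^ 2 * K3 s) := Set.indicator_of_mem hs _
      rw [hM]; simp only []; rw [hind, hgs]
      have := mul_le_mul_of_nonneg_left hT1 (hK3nn s)
      nlinarith
    · -- tail: |s| > D
      have hind : Set.indicator (Set.Icc (-D) D) (fun s => A₂ * (s ^ 2 * K3 s)) s = 0 := Set.indicator_of_notMem hs _
      rw [hM]; simp only []; rw [hind, hgs, zero_add]
      have hsD : D < |s| := by
        rw [Set.mem_Icc, not_and_or, not_le, not_le] at hs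
        rcases hs with h | h
        · exact lt_of_lt_of_le (by linarith) (neg_le_abs s)
        · exact lt_of_lt_of_le h (le_abs_self s)
      have hs0 : 0 < |s| := lt_trans hD hsD
      -- K3 s ≤ |s|⁻³
      have hK3le : K3 s ≤ (|s| ^ 3)⁻¹ := by
        have h := (stub_rosenheadMomentBounds).1 (Real.sqrt q) s hsq
        rw [Real.sq_sqrt hq.le] at h
        rw [le_inv_comm₀ (lt_of_le_of_ne (hK3nn s) ?_) (pow_pos hs0 3)]
        · calc |s| ^ 3 = |s| ^ 3 * K3 s * (K3 s)⁻¹ := by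
                rw [mul_assoc, mul_inv_cancel₀, mul_one]
                exact (inv_pos.2 (Real.rpow_pos_of_pos (by positivity) _)).ne'
            _ ≤ 1 * (K3 s)⁻¹ := mul_le_mul_of_nonneg_right h (inv_nonneg.2 (hK3nn s))
            _ = (K3 s)⁻¹ := one_mul _
        · exact (inv_pos.2 (Real.rpow_pos_of_pos (by positivity : (0:ℝ) < s ^ 2 + q) _)).ne'.symm
      -- (2A₀ + A₁|s|)/|s|³ ≤ C (s²+D²)⁻¹, i.e. D(2A₀ + A₁u)(u² + D²) ≤ (4A₀ + 2A₁D)u³ for u = |s| > D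
      have hs2 : s ^ 2 = |s| ^ 2 := (sq_abs s).symm
      set u := |s| with hu
      have hDu : D ≤ u := hsD.le
      have hu2 : D ^ 2 ≤ u ^ 2 := pow_le_pow_left₀ hD.le hDu 2
      have hu3 : D * u ^ 2 ≤ u ^ 3 := by nlinarith [sq_nonneg u]
      have hD3 : D ^ 3 ≤ u ^ 3 := pow_le_pow_left₀ hD.le hDu 3
      have hnum : 0 ≤ (4 * A₀ + 2 * A₁ * D) * u ^ 3 - D * (2 * A₀ + A₁ * u) * (u ^ 2 + D ^ 2) := by
        have e1 : (4 * A₀ + 2 * A₁ * D) * u ^ 3 - D * (2 * A₀ + A₁ * u) * (u ^ 2 + D ^ 2)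
            = 2 * A₀ * (u ^ 3 - D * u ^ 2) + 2 * A₀ * (u ^ 3 - D ^ 3) + A₁ * D * u * (u ^ 2 - D ^ 2) := by ring
        rw [e1]
        have t1 : 0 ≤ 2 * A₀ * (u ^ 3 - D * u ^ 2) := mul_nonneg (by positivity) (by linarith)
        have t2 : 0 ≤ 2 * A₀ * (u ^ 3 - D ^ 3) := mul_nonneg (by positivity) (by linarith)
        have t3 : 0 ≤ A₁ * D * u * (u ^ 2 - D ^ 2) := mul_nonneg (by positivity) (by linarith)
        linarith
      have hD0 : D ≠ 0 := hD.ne'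
      have hu0 : u ≠ 0 := hs0.ne'
      have hsum : u ^ 2 + D ^ 2 ≠ 0 := by positivity
      have hden : 0 < D * u ^ 3 * (u ^ 2 + D ^ 2) := by positivity
      have hkey : (2 * A₀ + A₁ * |s|) * (|s| ^ 3)⁻¹ ≤ C * (s ^ 2 + D ^ 2)⁻¹ := by
        rw [hs2, ← hu, ← sub_nonneg]
        have e2 : C * (u ^ 2 + D ^ 2)⁻¹ - (2 * A₀ + A₁ * u) * (u ^ 3)⁻¹
            = ((4 * A₀ + 2 * A₁ * D) * u ^ 3 - D * (2 * A₀ + A₁ * u) * (u ^ 2 + D ^ 2)) / (D * u ^ 3 * (u ^ 2 + D ^ 2)) := by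
          rw [hC]; field_simp
        rw [e2]
        exact div_nonneg hnum hden.le
      calc K3 s * |φ τ - φ (τ - s) - s * deriv φ (τ - s)| ≤ K3 s * (2 * A₀ + A₁ * |s|) := mul_le_mul_of_nonneg_left hT2 (hK3nn s)
        _ ≤ (|s| ^ 3)⁻¹ * (2 * A₀ + A₁ * |s|) := mul_le_mul_of_nonneg_right hK3le (by positivity)
        _ = (2 * A₀ + A₁ * |s|) * (|s| ^ 3)⁻¹ := mul_comm _ _
        _ ≤ C * (s ^ 2 + D ^ 2)⁻¹ := hkey
  -- integrate the majorant
  have hbound := norm_integral_le_of_norm_le hMi (Eventually.of_forall hdom)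
  rw [Real.norm_eq_abs] at hbound
  refine hbound.trans (le_of_eq ?_)
  rw [hM, integral_add hwin htail, integral_indicator measurableSet_Icc, integral_const_mul, integral_const_mul,
    integral_inv_sq_add_sq hD, integral_Icc_eq_integral_Ioc, ← intervalIntegral.integral_of_le (by linarith : -D ≤ D)]
  have hm := (stub_rosenheadMoments).2.2 (Real.sqrt q) D hsq hD.le
  rw [Real.sq_sqrt hq.le] at hm
  simp only [hK3]
  rw [hm]
  ring

end Summit.NavierStokesRegularity.NavierStokesRegularity.Theorems.Clause13RTaylorRemainderBounds

end
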